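import Summits.QuantumFields.BalabanUV.T4Continuum.Spine.NE2.OneStepRemainderDomination
import Summits.QuantumFields.BalabanUV.T4Continuum.Spine.NE2.ComposedAveragingRemainder

/-!
# T⁴ programme, spine node NE2 (U1a) — R14 W3 proper, file 3: THE COMPOSED REMAINDER `E″_k` OF THE FULL LINEARISED AVERAGING OVER THE LEVELS ([B7] (141)–(143)) AND ITS
# k-UNIFORM SIZE — the `opNorm_le` half of the displayed datum `hRem` of `ComposedAveragingRemainder.composed_averaging_remainder_rate`, CONSTRUCTED
# (cell `pub-balaban-gaps`, seat ne2 gen 5; plan `run/shared/lean/pub/pub-balaban-gaps/ne/NE2-R14-PLAN.md` W3)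

[B7] p. 39: «A composition of k operators Q is the operator Q_k. The operators Q″ do not compose in a simple way, but if we introduce an operator Q″_k by the formula
(Q″_kA)_c = Σ_{b⊂B^k(c₋)∪B^k(c₊)} η^dA_b, c ⊂ Ω^{(k)}, (141) then we have the inequality |Q″Q″_jA| ≤ Q″Q″_j|A| ≤ 2dQ″_{j+1}|A|. (142) Now we will prove by induction the bound
|Q_j(U₀)A| ≤ Q_j|A| + 2C′₁α₀(L^jη)²Q″_j|A|, j ≤ k, (143)».  In the tree's operator-norm currency the same induction reads: with the one-step full averaging `Q(V₀) = Q₀ + Q″(V₀)` of file 1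
(`OneStepRemainder.Qlin = Qstep Smain + Qrem`) at every step, the COMPOSED FULL AVERAGING `Q^{full}_k = Q^{lin}_0 ⋯ Q^{lin}_{k−1}` (**`QfullLev`**) differs from the composed MAIN TERM
`Q_k(T_Bal)` (`ComposedAveragingIdentity.QcovT_TBal_succ`) by the COMPOSED REMAINDER **`Erem`** `E″_k := √(n_k^d)·Q^{full}_k − (B_k + E_k(T_Bal))`, which obeys the recursion
**`Erem_succ`** `E″_{k+1} = √(L^d)·(E″_k·Q₀^{(k)} + (B_k + E_k(T_Bal) + E″_k)·Q″^{(k)})` and hence (**`opNorm_Erem_le_prod`**, **`opNorm_Erem_le`**) the k-UNIFORM SIZE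
  `‖E″_k‖ ≤ (1 + card o·τ)·c_R·(Σ_{i<k} γ_i)·Π_{i<k}(1 + card o·σ_i + c_R·γ_i) ≤ (1 + card o·τ)·c_R·Γ·e^{E}`,   `c_R = card o·2d(2d+2)L^d`,
from: the composed table's size letter `τ` (`‖T_Bal − 1‖ ≤ τ`, gen 3's `norm_TBal_sub_one_le`), the one-step main table's size letters `σ_i` (`‖Smain^{(i)} − 1‖ ≤ σ_i`), the coefficient letters
`γ_i` of (124)'s remainder at step `i` (print: `O(L²α₀(L^iη)²)` — (143)'s factor), their sums `Σ_{i<k} γ_i ≤ Γ`, `Σ_{i<k}(card o·σ_i + c_R·γ_i) ≤ E` (geometric in print's regime), and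
contractive transporters.  Tools (§1): the one-step table averaging's Schur sums (`sum_qone_row = 1`, `sum_qone_col = L^{−d}`), `Qstep_sub`, **`opNorm_Qstep_le_of_entry`**,
`opNorm_Qstep_one_le` (`‖√(L^d)·Q₁(1)‖ ≤ 1`), **`opNorm_Qstep_le_one_add`** (`‖√(L^d)·Q₁(S)‖ ≤ 1 + card o·σ`); `sqrtVol_succ`.
What this DISCHARGES: the `opNorm_le` field of `hRem : AveragingLaws (Δ_a⊗1) E″ (J⊗1) r (…)` for `E″ := Erem` with an explicit k-uniform `r`, modulo the displayed one-step letters; what it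
does NOT: the two sandwiched two-level fields of `hRem` (NE3-type consistency of the remainder between the problems at levels `k+1` and `k` — successor), the functional calculus
`G_i = g(∓i ad)…` from `Y, Y_x` ([B7] §A), and the letters for Bałaban's own minimiser (node NE3 + DIVERGENCE F6 (ζ)).
HONEST FRAMING (T4-DAG p. 1).  MODEL LEVEL; `W`, the coefficient data `C` and every letter on them are DISPLAYED hypotheses asserted by nobody; NOT NE2, NOT [B9] (3.16)/(3.26) or [B7]
(124)/(143) as printed; **NE2 (U1a) NOT PROVED**; spine PROVED 0/9 unchanged; NOT continuum YM / infinite volume / mass gap / Clay.  HONEST DEPENDENCY: continuum YM on T⁴ ⇐ BetaPertH ∧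
nine spine estimates (0/9 proved); BetaPertH ⇐ (D1) ∧ (D4) ∧ CAP+tail.  No `sorry`.
-/

noncomputable section

open scoped BigOperators ComplexConjugate Matrix Matrix.Norms.L2Operator Kronecker
open Finset (range)

namespace Summit.QuantumFields.BalabanUV.T4Continuum.NE2.ComposedRemainderTower

open Literature.MathematicalPhysics.QuantumFieldTheory.Balaban1983to89.B5Prop11Plancherel (Tor fine unitVec)
open Literature.MathematicalPhysics.QuantumFieldTheory.Balaban1983to89.B5Block118 (tstep)
open Literature.MathematicalPhysics.QuantumFieldTheory.Balaban1983to89.B5G183RateTorus (cpt)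
open Literature.MathematicalPhysics.QuantumFieldTheory.Balaban1983to89.B5G183RateTorusW (off)
open Literature.MathematicalPhysics.QuantumFieldTheory.Balaban1983to89.B5G183RateUnitTower (lev lev_neZero)
open Summit.QuantumFields.BalabanUV.T4Continuum
open Summit.QuantumFields.BalabanUV.T4Continuum.BalabanAveragedTowerUnit (idx norm_entry_le_opNorm)
open Summit.QuantumFields.BalabanUV.T4Continuum.CovariantBlockAveraging (opNorm_le_sqrt_of_schur sqrtVol norm_sqrtVol Bfree opNorm_Bfree_le)
open Summit.QuantumFields.BalabanUV.T4Continuum.CovariantVectorChartModulus (norm_transport_le_one)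
open Summit.QuantumFields.BalabanUV.T4Continuum.NE2.CovariantTableAveraging (Table QcovT)
open Summit.QuantumFields.BalabanUV.T4Continuum.NE2.CovariantTableTower (QcovLevT EcovT Bfree_add_EcovT opNorm_EcovT_le)
open Summit.QuantumFields.BalabanUV.T4Continuum.NE2.CovariantTableBalaban (TBal)
open Summit.QuantumFields.BalabanUV.T4Continuum.NE2.ComposedAveragingIdentity (Qstep stepTable QcovT_TBal_succ)
open Summit.QuantumFields.BalabanUV.T4Continuum.NE2.OneStepRemainder (blockInd blockInd_nonneg sum_blockInd_coarse Smain Qrem Qlin opNorm_Qrem_le)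

variable {d : ℕ}

/-! ## §1 The one-step table averaging: Schur sums and operator bounds -/

section Step

variable (n L : ℕ) [NeZero n] [NeZero L] (M : Fin d → ℕ) [hM : ∀ μ, NeZero (M μ)] {o : Type*} [Fintype o] [DecidableEq o]

omit [NeZero n] [NeZero L] hM [Fintype o] [DecidableEq o] in
/-- the one-step table averaging is linear in its table: `Q₁(S) − Q₁(S′) = Q₁(S − S′)`. [folklore] -/
theorem Qstep_sub (S S' : Tor (fine n M) → (Fin d → Fin L) → Fin d → ℕ → Matrix o o ℂ) :
    Qstep n L M S - Qstep n L M S' = Qstep n L M (fun x r μ s => S x r μ s - S' x r μ s) := by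
  ext b i
  simp only [Qstep, Matrix.sub_apply]
  by_cases h : i.1.2 = b.1.2
  · rw [if_pos h, if_pos h, if_pos h, ← Finset.sum_sub_distrib]
    refine Finset.sum_congr rfl fun r _ => ?_
    rw [← Finset.sum_sub_distrib]
    refine Finset.sum_congr rfl fun s _ => ?_
    split_ifs
    · rw [mul_sub]
    · rw [sub_zero]
  · rw [if_neg h, if_neg h, if_neg h, sub_zero]

/-- the modulus kernel of the one-step table averaging: `[ν = μ]·L^{−(d+1)}·#{(r,s) : z = L·x + r + s e_μ}`. [folklore] -/
def qone (b : Tor (fine n M) × Fin d) (i : Tor (fine (L * n) M) × Fin d) : ℝ :=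
  if i.2 = b.2 then ∑ r : Fin d → Fin L, ∑ s : Fin L, (if i.1 = cpt n L M b.1 + off n L M r + tstep (fine (L * n) M) b.2 (s : ℕ) then ((L : ℝ) ^ (d + 1))⁻¹ else 0)
  else 0

omit [NeZero n] [NeZero L] hM in
/-- `0 ≤ qone`. [folklore] -/
theorem qone_nonneg (b : Tor (fine n M) × Fin d) (i : Tor (fine (L * n) M) × Fin d) : 0 ≤ qone n L M b i := by
  unfold qone
  split_ifs
  · exact Finset.sum_nonneg fun r _ => Finset.sum_nonneg fun s _ => by split_ifs <;> positivity
  · exact le_rfl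

/-- ROW SUMS: `Σ_i qone b i = 1` (the `L^{d+1}` pairs `(r, s)` each hit one fine bond). [folklore] -/
theorem sum_qone_row (b : Tor (fine n M) × Fin d) : ∑ i : Tor (fine (L * n) M) × Fin d, qone n L M b i = 1 := by
  have hL : (L : ℝ) ≠ 0 := by exact_mod_cast NeZero.ne L
  set A : Tor (fine (L * n) M) → ℝ := fun z => ∑ r : Fin d → Fin L, ∑ s : Fin L,
    (if z = cpt n L M b.1 + off n L M r + tstep (fine (L * n) M) b.2 (s : ℕ) then ((L : ℝ) ^ (d + 1))⁻¹ else 0) with hA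
  have h1 : ∑ i : Tor (fine (L * n) M) × Fin d, qone n L M b i = ∑ z : Tor (fine (L * n) M), A z := by
    rw [Fintype.sum_prod_type]
    refine Finset.sum_congr rfl fun z _ => ?_
    have e : ∀ ν : Fin d, qone n L M b (z, ν) = if ν = b.2 then A z else 0 := fun ν => rfl
    simp only [e, Finset.sum_ite_eq', Finset.mem_univ, if_true]
  have h2 : ∑ z : Tor (fine (L * n) M), A z = ∑ r : Fin d → Fin L, ∑ s : Fin L, ((L : ℝ) ^ (d + 1))⁻¹ := by
    rw [hA, Finset.sum_comm]
    refine Finset.sum_congr rfl fun r _ => ?_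
    rw [Finset.sum_comm]
    refine Finset.sum_congr rfl fun s _ => ?_
    rw [Finset.sum_ite_eq', if_pos (Finset.mem_univ _)]
  rw [h1, h2]
  simp only [Finset.sum_const, Finset.card_univ, Fintype.card_fin, nsmul_eq_mul]
  rw [Fintype.card_fun, Fintype.card_fin, Fintype.card_fin]
  push_cast
  field_simp
  ring

/-- COLUMN SUMS: `Σ_b qone b i = L^{−d}` (for each `s < L` the fine point `z − s e_ν` has exactly one block decomposition). [folklore] -/
theorem sum_qone_col (i : Tor (fine (L * n) M) × Fin d) : ∑ b : Tor (fine n M) × Fin d, qone n L M b i = ((L : ℝ) ^ d)⁻¹ := by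
  have hL : (L : ℝ) ≠ 0 := by exact_mod_cast NeZero.ne L
  set A : Tor (fine n M) → Fin L → ℝ := fun x s => ∑ r : Fin d → Fin L,
    (if i.1 = cpt n L M x + off n L M r + tstep (fine (L * n) M) i.2 (s : ℕ) then ((L : ℝ) ^ (d + 1))⁻¹ else 0) with hA
  have h1 : ∑ b : Tor (fine n M) × Fin d, qone n L M b i = ∑ x : Tor (fine n M), ∑ s : Fin L, A x s := by
    rw [Fintype.sum_prod_type]
    refine Finset.sum_congr rfl fun x _ => ?_
    have e : ∀ μ : Fin d, qone n L M (x, μ) i = if i.2 = μ then ∑ s : Fin L, ∑ r : Fin d → Fin L,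
        (if i.1 = cpt n L M x + off n L M r + tstep (fine (L * n) M) μ (s : ℕ) then ((L : ℝ) ^ (d + 1))⁻¹ else 0) else 0 := by
      intro μ; simp only [qone]; split_ifs <;> [exact Finset.sum_comm; rfl]
    simp only [e, Finset.sum_ite_eq, Finset.mem_univ, if_true, hA]
  have key : ∀ s : Fin L, ∑ x : Tor (fine n M), A x s = ((L : ℝ) ^ (d + 1))⁻¹ := by
    intro s
    have hb := sum_blockInd_coarse n L M (i.1 - tstep (fine (L * n) M) i.2 (s : ℕ))
    have e : ∀ x : Tor (fine n M), A x s = ((L : ℝ) ^ (d + 1))⁻¹ * blockInd n L M x (i.1 - tstep (fine (L * n) M) i.2 (s : ℕ)) := by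
      intro x
      rw [hA, blockInd, Finset.mul_sum]
      refine Finset.sum_congr rfl fun r _ => ?_
      by_cases h : i.1 = cpt n L M x + off n L M r + tstep (fine (L * n) M) i.2 (s : ℕ)
      · rw [if_pos h, if_pos (sub_eq_of_eq_add h), mul_one]
      · rw [if_neg h, if_neg (fun h' => h (eq_add_of_sub_eq h')), mul_zero]
    simp only [e]
    rw [← Finset.mul_sum, hb, mul_one]
  rw [h1, Finset.sum_comm]
  simp only [key, Finset.sum_const, Finset.card_univ, Fintype.card_fin, nsmul_eq_mul]
  rw [pow_succ]
  field_simp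

/-- **ENTRY BOUND ⟹ OPERATOR BOUND FOR THE ONE-STEP TABLE AVERAGING**: if the colour entries of the table are dominated, `‖S(x,r,μ,s)_{αα′}‖ ≤ E α α′` (`s < L`), by a matrix `E` with
row and column sums `≤ c`, then `‖Q₁(S)‖ ≤ c·(√(L^d))⁻¹`. [folklore] -/
theorem opNorm_Qstep_le_of_entry {S : Tor (fine n M) → (Fin d → Fin L) → Fin d → ℕ → Matrix o o ℂ} {E : o → o → ℝ}
    (hE : ∀ x r μ (s : Fin L) α α', ‖S x r μ s α α'‖ ≤ E α α') {c : ℝ} (hc : 0 ≤ c) (hrow : ∀ α, ∑ α', E α α' ≤ c) (hcol : ∀ α', ∑ α, E α α' ≤ c) :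
    ‖Qstep n L M S‖ ≤ c * (Real.sqrt ((L : ℝ) ^ d))⁻¹ := by
  have hL : (0 : ℝ) < (L : ℝ) ^ d := pow_pos (by exact_mod_cast Nat.pos_of_ne_zero (NeZero.ne L)) d
  have hw : ‖(1 / (L : ℂ) ^ (d + 1))‖ = ((L : ℝ) ^ (d + 1))⁻¹ := by rw [one_div, norm_inv, norm_pow, Complex.norm_natCast]
  have hent : ∀ (b : (Tor (fine n M) × Fin d) × o) (i : (Tor (fine (L * n) M) × Fin d) × o), ‖Qstep n L M S b i‖ ≤ qone n L M b.1 i.1 * E b.2 i.2 := by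
    intro b i
    rw [Qstep, qone]
    by_cases hμ : i.1.2 = b.1.2
    · rw [if_pos hμ, if_pos hμ, Finset.sum_mul]
      refine (norm_sum_le _ _).trans (Finset.sum_le_sum fun r _ => ?_)
      rw [Finset.sum_mul]
      refine (norm_sum_le _ _).trans (Finset.sum_le_sum fun s _ => ?_)
      split_ifs
      · rw [norm_mul, hw]; exact mul_le_mul_of_nonneg_left (hE _ _ _ _ _ _) (by positivity)
      · rw [norm_zero, zero_mul]
    · rw [if_neg hμ, if_neg hμ, norm_zero, zero_mul]
  have hrow' : ∀ b : (Tor (fine n M) × Fin d) × o, ∑ i : (Tor (fine (L * n) M) × Fin d) × o, ‖Qstep n L M S b i‖ ≤ c := by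
    intro b
    calc _ ≤ ∑ i : (Tor (fine (L * n) M) × Fin d) × o, qone n L M b.1 i.1 * E b.2 i.2 := Finset.sum_le_sum fun i _ => hent b i
      _ = (∑ i1 : Tor (fine (L * n) M) × Fin d, qone n L M b.1 i1) * ∑ α', E b.2 α' := by
          rw [Fintype.sum_prod_type, Finset.sum_mul_sum]
      _ ≤ c := by rw [sum_qone_row, one_mul]; exact hrow b.2
  have hcol' : ∀ i : (Tor (fine (L * n) M) × Fin d) × o, ∑ b : (Tor (fine n M) × Fin d) × o, ‖Qstep n L M S b i‖ ≤ c * ((L : ℝ) ^ d)⁻¹ := by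
    intro i
    calc _ ≤ ∑ b : (Tor (fine n M) × Fin d) × o, qone n L M b.1 i.1 * E b.2 i.2 := Finset.sum_le_sum fun b _ => hent b i
      _ = (∑ b1 : Tor (fine n M) × Fin d, qone n L M b1 i.1) * ∑ α, E α i.2 := by
          rw [Fintype.sum_prod_type, Finset.sum_mul_sum]
      _ ≤ ((L : ℝ) ^ d)⁻¹ * c := by rw [sum_qone_col]; exact mul_le_mul_of_nonneg_left (hcol i.2) (by positivity)
      _ = c * ((L : ℝ) ^ d)⁻¹ := mul_comm _ _
  refine (opNorm_le_sqrt_of_schur _ hc (by positivity) hrow' hcol').trans (le_of_eq ?_)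
  rw [show c * (c * ((L : ℝ) ^ d)⁻¹) = c ^ 2 * ((L : ℝ) ^ d)⁻¹ by ring, Real.sqrt_mul (sq_nonneg _), Real.sqrt_sq hc, Real.sqrt_inv]

/-- **`‖√(L^d)·Q₁(1)‖ ≤ 1`**: the trivial-table one-step averaging is a contraction in the tower's normalisation. [folklore] -/
theorem opNorm_Qstep_one_le : ‖Qstep n L M (fun _ _ _ _ => (1 : Matrix o o ℂ))‖ ≤ (Real.sqrt ((L : ℝ) ^ d))⁻¹ := by
  have h := opNorm_Qstep_le_of_entry n L M (S := fun _ _ _ _ => (1 : Matrix o o ℂ)) (E := fun α α' => if α = α' then 1 else 0)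
    (fun x r μ s α α' => by rw [Matrix.one_apply]; split_ifs <;> simp) zero_le_one
    (fun α => by rw [Finset.sum_ite_eq, if_pos (Finset.mem_univ _)]) (fun α' => by rw [Finset.sum_ite_eq', if_pos (Finset.mem_univ _)])
  rwa [one_mul] at h

/-- **`‖√(L^d)·Q₁(S)‖ ≤ 1 + card o·σ`** when `‖S − 1‖ ≤ σ` entrywise (`s < L`). [folklore] -/
theorem opNorm_Qstep_le_one_add {S : Tor (fine n M) → (Fin d → Fin L) → Fin d → ℕ → Matrix o o ℂ} {σ : ℝ} (hσ : 0 ≤ σ)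
    (hS : ∀ x r μ (s : Fin L), ‖S x r μ s - 1‖ ≤ σ) : ‖Qstep n L M S‖ ≤ (1 + Fintype.card o * σ) * (Real.sqrt ((L : ℝ) ^ d))⁻¹ := by
  have hdiff : ‖Qstep n L M S - Qstep n L M (fun _ _ _ _ => (1 : Matrix o o ℂ))‖ ≤ Fintype.card o * σ * (Real.sqrt ((L : ℝ) ^ d))⁻¹ := by
    rw [Qstep_sub]
    have h := opNorm_Qstep_le_of_entry n L M (S := fun x r μ s => S x r μ s - 1) (E := fun _ _ => σ)
      (fun x r μ s α α' => (norm_entry_le_opNorm _ _ _).trans (hS x r μ s)) (c := Fintype.card o * σ) (mul_nonneg (Nat.cast_nonneg _) hσ)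
      (fun α => by rw [Finset.sum_const, Finset.card_univ, nsmul_eq_mul]) (fun α' => by rw [Finset.sum_const, Finset.card_univ, nsmul_eq_mul])
    exact h
  calc ‖Qstep n L M S‖ = ‖Qstep n L M (fun _ _ _ _ => (1 : Matrix o o ℂ)) + (Qstep n L M S - Qstep n L M (fun _ _ _ _ => (1 : Matrix o o ℂ)))‖ := by
        rw [add_sub_cancel]
    _ ≤ (Real.sqrt ((L : ℝ) ^ d))⁻¹ + Fintype.card o * σ * (Real.sqrt ((L : ℝ) ^ d))⁻¹ := (norm_add_le _ _).trans (add_le_add (opNorm_Qstep_one_le n L M) hdiff)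
    _ = (1 + Fintype.card o * σ) * (Real.sqrt ((L : ℝ) ^ d))⁻¹ := by ring

end Step

/-! ## §2 The composed full averaging and the composed remainder `E″_k` -/

section Tower

variable (L : ℕ) [NeZero L] (M : Fin d → ℕ) [hM : ∀ μ, NeZero (M μ)] {o : Type*} [Fintype o] [DecidableEq o]

omit [NeZero L] in
/-- `√(n_{k+1}^d) = √(L^d)·√(n_k^d)`. [folklore] -/
theorem sqrtVol_succ (k : ℕ) : sqrtVol d L (k + 1) = ((Real.sqrt ((L : ℝ) ^ d) : ℝ) : ℂ) * sqrtVol d L k := by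
  rw [sqrtVol, sqrtVol, ← Complex.ofReal_mul, ← Real.sqrt_mul (pow_nonneg (Nat.cast_nonneg _) d)]
  congr 2
  rw [show lev L (k + 1) = L * lev L k from rfl]
  push_cast
  ring

/-- the COEFFICIENT DATA of (124)'s remainder at every step `i` (level `i → i+1`): `G₁, G₂, G₃` and `R̄_{0,c}` of `OneStepRemainder.Qrem`, per coarse bond / block site of the level-`i`
lattice (print: functions of the background's loop logarithms `Y, Y_x` at that step; DATA here). [folklore] -/
structure RemCoeff (d L : ℕ) (M : Fin d → ℕ) (o : Type*) where
  /-- the comb coefficient `g(−i ad_Y)g⁻¹(−i ad_{Y_x}) − 1` at step `i` -/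
  G₁ : (i : ℕ) → Tor (fine (lev L i) M) → Fin d → (Fin d → Fin L) → Matrix o o ℂ
  /-- the end-comb coefficient `g(−i ad_Y)g⁻¹(i ad_{Y_x})e^{−i ad_Y} − 1` at step `i` -/
  G₂ : (i : ℕ) → Tor (fine (lev L i) M) → Fin d → (Fin d → Fin L) → Matrix o o ℂ
  /-- the axis coefficient `e^{i ad_Y} − g(−i ad_Y)Σ_x L^{−d}g⁻¹(i ad_{Y_x})` at step `i` -/
  G₃ : (i : ℕ) → Tor (fine (lev L i) M) → Fin d → Matrix o o ℂ
  /-- the coarse-bond transporter `R̄_{0,c} = R((V̄₀)_c)` at step `i` -/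
  Rc : (i : ℕ) → Tor (fine (lev L i) M) → Fin d → Matrix o o ℂ

/-- the one-step REMAINDER at step `k` for the data tower `W` (fine transporters `W (k+1)`). [folklore] -/
def QremStep (W : (i : ℕ) → Fin d → (idx L M i → Matrix o o ℂ)) (C : RemCoeff d L M o) (k : ℕ) : Matrix (idx L M k × o) (idx L M (k + 1) × o) ℂ :=
  haveI := lev_neZero L k
  Qrem (lev L k) L M (W (k + 1)) (C.G₁ k) (C.G₂ k) (C.G₃ k) (C.Rc k)

/-- the one-step MAIN-TERM averaging at step `k` for the data tower `W`: `Q₁(Smain(W (k+1)))` (= `Qstep (stepTable W k)` of `ComposedAveragingIdentity`). [folklore] -/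
def QmainStep (W : (i : ℕ) → Fin d → (idx L M i → Matrix o o ℂ)) (k : ℕ) : Matrix (idx L M k × o) (idx L M (k + 1) × o) ℂ :=
  haveI := lev_neZero L k
  Qstep (lev L k) L M (Smain (lev L k) L M (W (k + 1)))

/-- the FULL one-step linearised averaging (124) at step `k`: `Q₁(Smain) + Q″`. [folklore] -/
def QlinStep (W : (i : ℕ) → Fin d → (idx L M i → Matrix o o ℂ)) (C : RemCoeff d L M o) (k : ℕ) : Matrix (idx L M k × o) (idx L M (k + 1) × o) ℂ :=
  haveI := lev_neZero L k
  Qlin (lev L k) L M (W (k + 1)) (C.G₁ k) (C.G₂ k) (C.G₃ k) (C.Rc k)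

/-- **THE COMPOSED FULL LINEARISED AVERAGING** `Q^{full}_k = Q^{lin}_0 ⋯ Q^{lin}_{k−1}` (from level-`k` bond fields to unit-lattice bond fields); at `k = 0` the identity table averaging.
[cite: Balaban1985BackgroundPropagators, (3.15) p.393; Balaban1985Averaging, (124) p.36 (shape)] [folklore] -/
def QfullLev (W : (i : ℕ) → Fin d → (idx L M i → Matrix o o ℂ)) (C : RemCoeff d L M o) : (k : ℕ) → Matrix ((Tor M × Fin d) × o) (idx L M k × o) ℂ
  | 0 => QcovLevT L M (fun k => TBal L M W k) 0
  | k + 1 => QfullLev W C k * QlinStep L M W C k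

/-- **THE COMPOSED REMAINDER** `E″_k := √(n_k^d)·Q^{full}_k − (B_k + E_k(T_Bal))` — the error of the full composed averaging beyond the composed main-term table, in the tower's
normalisation (the `E″` slot of `ComposedAveragingRemainder.avgPertFull`). [folklore] -/
def Erem (W : (i : ℕ) → Fin d → (idx L M i → Matrix o o ℂ)) (C : RemCoeff d L M o) (k : ℕ) : Matrix ((Tor M × Fin d) × o) (idx L M k × o) ℂ :=
  sqrtVol d L k • QfullLev L M W C k - (Bfree L M k + EcovT L M (fun k => TBal L M W k) k)

/-- `B_k + E_k(T_Bal) + E″_k = √(n_k^d)·Q^{full}_k`. [folklore] -/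
theorem Bfree_add_EcovT_add_Erem (W : (i : ℕ) → Fin d → (idx L M i → Matrix o o ℂ)) (C : RemCoeff d L M o) (k : ℕ) :
    Bfree L M k + EcovT L M (fun k => TBal L M W k) k + Erem L M W C k = sqrtVol d L k • QfullLev L M W C k := by
  rw [Erem]; abel

/-- at level `0` there is no remainder. [folklore] -/
theorem Erem_zero (W : (i : ℕ) → Fin d → (idx L M i → Matrix o o ℂ)) (C : RemCoeff d L M o) : Erem L M W C 0 = 0 := by
  rw [Erem, QfullLev, ← Bfree_add_EcovT, sub_self]

omit hM in
/-- the full step splits: `Q^{lin}_k = Q^{main}_k + Q″_k`. [folklore] -/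
theorem QlinStep_eq (W : (i : ℕ) → Fin d → (idx L M i → Matrix o o ℂ)) (C : RemCoeff d L M o) (k : ℕ) :
    QlinStep L M W C k = QmainStep L M W k + QremStep L M W C k := rfl

/-- the composed main term factorises through the main step: `B_{k+1} + E_{k+1}(T_Bal) = √(n_{k+1}^d)·(Q_k(T_Bal)·Q^{main}_k)` (`QcovT_TBal_succ`). [folklore] -/
theorem Bfree_add_EcovT_succ (W : (i : ℕ) → Fin d → (idx L M i → Matrix o o ℂ)) (k : ℕ) :
    Bfree L M (k + 1) + EcovT L M (fun k => TBal L M W k) (k + 1) = sqrtVol d L (k + 1) • (QcovLevT L M (fun k => TBal L M W k) k * QmainStep L M W k) := by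
  rw [Bfree_add_EcovT, QcovLevT, QcovLevT, QcovT_TBal_succ]; rfl

/-- **THE RECURSION** ((141)–(143)'s induction step in operator form): `E″_{k+1} = √(L^d)·(E″_k·Q^{main}_k + (B_k + E_k(T_Bal) + E″_k)·Q″_k)`. [folklore] -/
theorem Erem_succ (W : (i : ℕ) → Fin d → (idx L M i → Matrix o o ℂ)) (C : RemCoeff d L M o) (k : ℕ) :
    Erem L M W C (k + 1)
      = ((Real.sqrt ((L : ℝ) ^ d) : ℝ) : ℂ) • (Erem L M W C k * QmainStep L M W k + (Bfree L M k + EcovT L M (fun k => TBal L M W k) k + Erem L M W C k) * QremStep L M W C k) := by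
  have hQ : sqrtVol d L k • QcovLevT L M (fun k => TBal L M W k) k = Bfree L M k + EcovT L M (fun k => TBal L M W k) k := (Bfree_add_EcovT L M _ k).symm
  rw [Erem, Bfree_add_EcovT_succ, QfullLev, QlinStep_eq, sqrtVol_succ, mul_smul, mul_smul, ← smul_sub, ← Matrix.smul_mul, ← Matrix.smul_mul,
    ← Bfree_add_EcovT_add_Erem L M W C k, hQ, Matrix.mul_add,
    Matrix.add_mul (Bfree L M k + EcovT L M (fun k => TBal L M W k) k) (Erem L M W C k) (QmainStep L M W k)]
  congr 1
  abel

end Tower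

/-! ## §3 The k-uniform size of the composed remainder -/

section Size

variable (L : ℕ) [NeZero L] (M : Fin d → ℕ) [hM : ∀ μ, NeZero (M μ)] {o : Type*} [Fintype o] [DecidableEq o] [Nonempty o]

variable (d) (o) in
/-- the one-step remainder's operator constant `c_R = card o·2d·(2d+2)·L^d` of `OneStepRemainder.opNorm_Qrem_le` (print's `C′₁`-type constant, depending on `d`, `L` and the colour
dimension). [folklore] -/
def cR : ℝ := Fintype.card o * (2 * d * ((2 * d + 2) * (L : ℝ) ^ d))

omit [NeZero L] hM [DecidableEq o] [Nonempty o] in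
/-- `0 ≤ c_R`. [folklore] -/
theorem cR_nonneg : 0 ≤ cR d L o := by unfold cR; positivity

/-- **THE SIZE OF THE COMPOSED REMAINDER, PRODUCT FORM**:
`‖E″_k‖ ≤ (1 + card o·τ)·c_R·(Σ_{i<k} γ_i)·Π_{i<k}(1 + card o·σ_i + c_R·γ_i)`. [cite: Balaban1985Averaging, (141)–(143) p.39 (shape)] [folklore] -/
theorem opNorm_Erem_le_prod {W : (i : ℕ) → Fin d → (idx L M i → Matrix o o ℂ)} {C : RemCoeff d L M o} {τ : ℝ} {σ γ : ℕ → ℝ}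
    (hτ0 : 0 ≤ τ) (hσ0 : ∀ i, 0 ≤ σ i) (hγ0 : ∀ i, 0 ≤ γ i) (hWn : ∀ i ν b, ‖W i ν b‖ ≤ 1)
    (hτ : ∀ k y j μ (t : Fin (lev L k)), ‖TBal L M W k y j μ t - 1‖ ≤ τ)
    (hσ : ∀ k x r μ (s : Fin L), ‖(haveI := lev_neZero L k; Smain (lev L k) L M (W (k + 1)) x r μ s) - 1‖ ≤ σ k)
    (hG₁ : ∀ k x μ r, ‖C.G₁ k x μ r‖ ≤ γ k) (hG₂ : ∀ k x μ r, ‖C.G₂ k x μ r‖ ≤ γ k) (hG₃ : ∀ k x μ, ‖C.G₃ k x μ‖ ≤ γ k) (hRc : ∀ k x μ, ‖C.Rc k x μ‖ ≤ 1) (k : ℕ) :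
    ‖Erem L M W C k‖ ≤ (1 + Fintype.card o * τ) * cR d L o * (∑ i ∈ range k, γ i) * ∏ i ∈ range k, (1 + (Fintype.card o * σ i + cR d L o * γ i)) := by
  have hco : (0 : ℝ) ≤ Fintype.card o := Nat.cast_nonneg _
  have hcR := cR_nonneg (d := d) L (o := o)
  have hsL : (0 : ℝ) < Real.sqrt ((L : ℝ) ^ d) := Real.sqrt_pos.mpr (pow_pos (by exact_mod_cast Nat.pos_of_ne_zero (NeZero.ne L)) d)
  induction k with
  | zero => simp [Erem_zero]
  | succ k ih =>
    haveI := lev_neZero L k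
    -- the three operator sizes at step k
    have hB : ‖Bfree L M k + EcovT L M (fun k => TBal L M W k) k‖ ≤ 1 + Fintype.card o * τ :=
      (norm_add_le _ _).trans (add_le_add (opNorm_Bfree_le L M k) (opNorm_EcovT_le L M hτ0 hτ k))
    have hQ : ‖QmainStep L M W k‖ ≤ (1 + Fintype.card o * σ k) * (Real.sqrt ((L : ℝ) ^ d))⁻¹ :=
      opNorm_Qstep_le_one_add (lev L k) L M (hσ0 k) (hσ k)
    have hR : ‖QremStep L M W C k‖ ≤ cR d L o * γ k * (Real.sqrt ((L : ℝ) ^ d))⁻¹ := by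
      have h := opNorm_Qrem_le (lev L k) L M (hγ0 k) (hWn (k + 1)) (hG₁ k) (hG₂ k) (hG₃ k) (hRc k)
      refine h.trans (le_of_eq ?_)
      rw [cR]; ring
    have hnsL : ‖((Real.sqrt ((L : ℝ) ^ d) : ℝ) : ℂ)‖ = Real.sqrt ((L : ℝ) ^ d) := by rw [Complex.norm_real, Real.norm_of_nonneg hsL.le]
    set e := ‖Erem L M W C k‖ with he
    set P := ∏ i ∈ range k, (1 + (Fintype.card o * σ i + cR d L o * γ i)) with hP
    set Sγ := ∑ i ∈ range k, γ i with hS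
    have hε0 : ∀ i, 0 ≤ Fintype.card o * σ i + cR d L o * γ i := fun i => add_nonneg (mul_nonneg hco (hσ0 i)) (mul_nonneg hcR (hγ0 i))
    have hP1 : 1 ≤ P := by
      rw [hP]
      calc (1 : ℝ) = ∏ _i ∈ range k, (1 : ℝ) := Finset.prod_const_one.symm
        _ ≤ ∏ i ∈ range k, (1 + (Fintype.card o * σ i + cR d L o * γ i)) :=
          Finset.prod_le_prod (fun _ _ => zero_le_one) fun i _ => le_add_of_nonneg_right (hε0 i)
    have hSγ : 0 ≤ Sγ := Finset.sum_nonneg fun i _ => hγ0 i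
    have he0 : 0 ≤ e := norm_nonneg _
    -- the recursion estimate
    have hτe : 0 ≤ 1 + Fintype.card o * τ + e := by positivity
    have hstep : ‖Erem L M W C (k + 1)‖ ≤ e * (1 + Fintype.card o * σ k) + (1 + Fintype.card o * τ + e) * (cR d L o * γ k) := by
      rw [Erem_succ, norm_smul, hnsL]
      have h1 : ‖Erem L M W C k * QmainStep L M W k‖ ≤ e * ((1 + Fintype.card o * σ k) * (Real.sqrt ((L : ℝ) ^ d))⁻¹) :=
        (Matrix.l2_opNorm_mul _ _).trans (mul_le_mul_of_nonneg_left hQ he0)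
      have h2 : ‖(Bfree L M k + EcovT L M (fun k => TBal L M W k) k + Erem L M W C k) * QremStep L M W C k‖
          ≤ (1 + Fintype.card o * τ + e) * (cR d L o * γ k * (Real.sqrt ((L : ℝ) ^ d))⁻¹) :=
        (Matrix.l2_opNorm_mul _ _).trans (mul_le_mul ((norm_add_le _ _).trans (add_le_add hB le_rfl)) hR (norm_nonneg _) hτe)
      calc Real.sqrt ((L : ℝ) ^ d) * ‖Erem L M W C k * QmainStep L M W k + (Bfree L M k + EcovT L M (fun k => TBal L M W k) k + Erem L M W C k) * QremStep L M W C k‖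
          ≤ Real.sqrt ((L : ℝ) ^ d) * (e * ((1 + Fintype.card o * σ k) * (Real.sqrt ((L : ℝ) ^ d))⁻¹)
              + (1 + Fintype.card o * τ + e) * (cR d L o * γ k * (Real.sqrt ((L : ℝ) ^ d))⁻¹)) :=
            mul_le_mul_of_nonneg_left ((norm_add_le _ _).trans (add_le_add h1 h2)) hsL.le
        _ = e * (1 + Fintype.card o * σ k) + (1 + Fintype.card o * τ + e) * (cR d L o * γ k) := by field_simp
    -- close the induction
    refine hstep.trans ?_
    rw [Finset.sum_range_succ, Finset.prod_range_succ, ← hS, ← hP]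
    have ih' : e ≤ (1 + Fintype.card o * τ) * cR d L o * Sγ * P := ih
    have hK : 0 ≤ (1 + Fintype.card o * τ) * cR d L o := by positivity
    have hεk := hε0 k
    have a1 : e * (1 + Fintype.card o * σ k) + (1 + Fintype.card o * τ + e) * (cR d L o * γ k)
        = e * (1 + (Fintype.card o * σ k + cR d L o * γ k)) + (1 + Fintype.card o * τ) * cR d L o * γ k := by ring
    have a2 : e * (1 + (Fintype.card o * σ k + cR d L o * γ k)) ≤ (1 + Fintype.card o * τ) * cR d L o * Sγ * P * (1 + (Fintype.card o * σ k + cR d L o * γ k)) :=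
      mul_le_mul_of_nonneg_right ih' (by linarith)
    have a3 : (1 + Fintype.card o * τ) * cR d L o * γ k ≤ (1 + Fintype.card o * τ) * cR d L o * γ k * (P * (1 + (Fintype.card o * σ k + cR d L o * γ k))) :=
      le_mul_of_one_le_right (mul_nonneg hK (hγ0 k)) (one_le_mul_of_one_le_of_one_le hP1 (by linarith))
    rw [a1]
    refine (add_le_add a2 a3).trans (le_of_eq ?_)
    ring

/-- **THE k-UNIFORM SIZE OF THE COMPOSED REMAINDER**: with `Σ_{i<k} γ_i ≤ Γ` and `Σ_{i<k}(card o·σ_i + c_R·γ_i) ≤ E` for all `k` (both sums are GEOMETRIC in print's regime: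
`σ_i = O(L·α(L^iη))`, `γ_i = O(L²α₀(L^iη)²)`), `‖E″_k‖ ≤ (1 + card o·τ)·c_R·Γ·e^{E}` — the `opNorm_le` field of the `E″` datum of `composed_averaging_remainder_rate`, CONSTRUCTED.
[cite: Balaban1985Averaging, (143) p.39 (shape)] [folklore] -/
theorem opNorm_Erem_le {W : (i : ℕ) → Fin d → (idx L M i → Matrix o o ℂ)} {C : RemCoeff d L M o} {τ Γ E : ℝ} {σ γ : ℕ → ℝ}
    (hτ0 : 0 ≤ τ) (hσ0 : ∀ i, 0 ≤ σ i) (hγ0 : ∀ i, 0 ≤ γ i) (hWn : ∀ i ν b, ‖W i ν b‖ ≤ 1)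
    (hτ : ∀ k y j μ (t : Fin (lev L k)), ‖TBal L M W k y j μ t - 1‖ ≤ τ)
    (hσ : ∀ k x r μ (s : Fin L), ‖(haveI := lev_neZero L k; Smain (lev L k) L M (W (k + 1)) x r μ s) - 1‖ ≤ σ k)
    (hG₁ : ∀ k x μ r, ‖C.G₁ k x μ r‖ ≤ γ k) (hG₂ : ∀ k x μ r, ‖C.G₂ k x μ r‖ ≤ γ k) (hG₃ : ∀ k x μ, ‖C.G₃ k x μ‖ ≤ γ k) (hRc : ∀ k x μ, ‖C.Rc k x μ‖ ≤ 1)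
    (hΓ : ∀ k, ∑ i ∈ range k, γ i ≤ Γ) (hE : ∀ k, ∑ i ∈ range k, (Fintype.card o * σ i + cR d L o * γ i) ≤ E) (k : ℕ) :
    ‖Erem L M W C k‖ ≤ (1 + Fintype.card o * τ) * cR d L o * Γ * Real.exp E := by
  have hK : 0 ≤ (1 + Fintype.card o * τ) * cR d L o := by have := cR_nonneg (d := d) L (o := o); positivity
  have hprod : ∏ i ∈ range k, (1 + (Fintype.card o * σ i + cR d L o * γ i)) ≤ Real.exp E := by
    have hcR := cR_nonneg (d := d) L (o := o)
    have hε0 : ∀ i, 0 ≤ Fintype.card o * σ i + cR d L o * γ i := fun i => add_nonneg (mul_nonneg (Nat.cast_nonneg _) (hσ0 i)) (mul_nonneg hcR (hγ0 i))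
    calc ∏ i ∈ range k, (1 + (Fintype.card o * σ i + cR d L o * γ i)) ≤ ∏ i ∈ range k, Real.exp (Fintype.card o * σ i + cR d L o * γ i) :=
          Finset.prod_le_prod (fun i _ => by linarith [hε0 i]) fun i _ => by
            have := Real.add_one_le_exp (Fintype.card o * σ i + cR d L o * γ i); linarith
      _ = Real.exp (∑ i ∈ range k, (Fintype.card o * σ i + cR d L o * γ i)) := (Real.exp_sum _ _).symm
      _ ≤ Real.exp E := Real.exp_le_exp.mpr (hE k)
  have hSγ : 0 ≤ ∑ i ∈ range k, γ i := Finset.sum_nonneg fun i _ => hγ0 i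
  calc ‖Erem L M W C k‖ ≤ (1 + Fintype.card o * τ) * cR d L o * (∑ i ∈ range k, γ i) * ∏ i ∈ range k, (1 + (Fintype.card o * σ i + cR d L o * γ i)) :=
        opNorm_Erem_le_prod L M hτ0 hσ0 hγ0 hWn hτ hσ hG₁ hG₂ hG₃ hRc k
    _ ≤ (1 + Fintype.card o * τ) * cR d L o * Γ * Real.exp E := by
        have h1 : (1 + Fintype.card o * τ) * cR d L o * (∑ i ∈ range k, γ i) ≤ (1 + Fintype.card o * τ) * cR d L o * Γ := mul_le_mul_of_nonneg_left (hΓ k) hK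
        have hcR := cR_nonneg (d := d) L (o := o)
        exact mul_le_mul h1 hprod (Finset.prod_nonneg fun i _ => by
            linarith [add_nonneg (mul_nonneg (Nat.cast_nonneg _ : (0 : ℝ) ≤ Fintype.card o) (hσ0 i)) (mul_nonneg hcR (hγ0 i))])
          (mul_nonneg hK (hSγ.trans (hΓ k)))

end Size

end Summit.QuantumFields.BalabanUV.T4Continuum.NE2.ComposedRemainderTower

end
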